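import Summits.QuantumFields.BalabanUV.Beta.NVertexSectors
import Summits.QuantumFields.BalabanUV.Beta.SLamFiniteSourceContraction
import Summits.QuantumFields.BalabanUV.Beta.CombHId1Letters
import Summits.QuantumFields.BalabanUV.Beta.CompositeVertexKernelUnroll
import Summits.QuantumFields.BalabanUV.Beta.CompositeVertexKernelLiftContract

/-!
# `BalabanUV.Beta.NVertexLamSectorContracted` — row D1 ∕ (C1), PART 14: **THE Λ SECTOR OF THE N-VERTEX's FIELD BLOCK, CONTRACTED — the column goes onto the
# multiplier coefficients: `ℒN|ff = −Σ_ν Σ'_w Λ′_N(ν,w) · compH ν w|ff` with `Λ′_N(ν,w) = Σ_{κ′} Σ'_u (AN R j) u (L•y) (inl κ′) (inr μ) · lamCoeffOf (KInv L) L ν w κ′ u`,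
# and the composite constraint-Hessian table's field block unrolled by storeys** (the row half of (J-Λ), first word)

WHY (located).  Road FP's RULING R-FP-77 (journal l.67224, on the row's J-RISK-1′) closes the `X`-conjugation question and leaves TWO junctions for the END wrapper's
`hHN₁`: (J-W) (the road's ∕ leaf-06's) and **(J-Λ)** `w n (n+1) • Σ_ā hb ā • Λ_ā|ff + compSumSym … = cΛ (n+2) • Σ_b colN b • (perF T (dper T (S^Λ_b)))|ff`, «ROW AND
ROAD by name».  PART 10 displayed the Λ sector of `VN R P j μ y|ff` as the chain-rule vertex `ℒN := vertexOfK (AN R j) L (SLam L (lamCoeffOf (KInv L) L) (compH R.r Lc (j+1)))`,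
`L = Lc^(j+1)` — the COLUMN index `(κ′, u)` outermost.  The road's storey words (`𝒦_j`, `w k·hb k ā = cΛ·Σ_m λ′_k …`) are indexed by the MULTIPLIER slot `(ν, w)` of the
constraint-Hessian table.  THIS FILE performs the ONE exchange between the two (a Fubini over `(u, w) ∈ ℤ^{d+1} × ℤ^{d+1}`, absolutely convergent because the column
decays from `L•y` (`decays_AN`, an4 `abs_colH_le`), the multiplier coefficients decay from the fine bond (lit `abs_lamCoeffOf_le` at `decays_KInv`) and the table is bounded
((LH), lit `bdd_of_biLoc`) — an2 g42's 2D tool `CombHId1Letters.summable_of_translate_bound`): generically (§1 **`vertexOfK_SLam_apply_contracted`**) and at the record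
(§2 **`LN_inl_inl_contracted`**, **`VN_inl_inl_contracted`**): `VN R P j μ y x z (inl α) (inl β) = cE (j+1)·𝒲N μ y x z (inl α) (inl β) − cΛ (j+1)·Σ_ν Σ'_w Λ′_N μ y ν w · compH R.r Lc (j+1) ν w x z (inl α) (inl β)`
with the CONTRACTED MULTIPLIER RESPONSE `Λ′_N μ y ν w := Σ_{κ′} Σ'_u (AN R j) u (L•y) (inl κ′) (inr μ) · lamCoeffOf (KInv L) L ν w κ′ u` (written out, no `def`) — the object to which
the road's storey-weight junctions and (K1) for the nested column apply (g60 PART 3 ∕ 5 ∕ 7: at depth 1, `Λ′ = −` the column's own multiplier).  §3 reads the table's field block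
by storeys (F6a′ `compHessFF_unroll_apply`, `packFF_inl_inl`): `compH r L m ν w x z (inl α) (inl β) = Σ_{k<m} liftUp ℓ L k (storeyVH ℓ 𝒽 L k · · (α,x) (β,z)) (m−1−k) ν w` at the
symmetrised bricks, and §3's last theorem DOES put `Σ'_w Λ′_N ν w · (…)` storey by storey (F6a‴ `tsum_mul_compVHKer_eq`, with `summable_LamN` and the bricks' bounds) — the
row's half of (J-Λ) up to the road's storey-weight scalar junctions and (K1) for the nested column.

WHAT ([folklore] `tsum` bookkeeping BY NAME; no `def`, no `def … : Prop`, nothing cited, 0 sorry): §1 `summable_col_coeff_table` (the 2D summability), `tsum_col_mul_SLam_apply`,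
**`vertexOfK_SLam_apply_contracted`**, `summable_contracted_coeff`; §2 `bdd_compH`, **`LN_inl_inl_contracted`**, `summable_LamN`, **`VN_inl_inl_contracted`**; §3 `compH_inl_inl_unroll`, `compH_inl_inl_eq_compVHKer`, **`tsum_LamN_mul_compH_inl_inl_storeys`** (THE CONTRACTED Λ SECTOR IN STOREY CURRENCY:
`Σ'_w Λ′_N ν w · compH ν w|ff = Σ_{k ≤ j} Σ_κ Σ'_s (Σ'_w Λ′_N ν w · compLinKer ℓ Lc (j−k) (κ,s) (ν,w)) · storeyVH ℓ 𝒽 Lc k κ s (α,x) (β,z)` — F6a‴ `tsum_mul_compVHKer_eq` at `Λ′_N`).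
WHAT THIS IS NOT: not (J-Λ) itself (the storey-weight scalar junctions and the periodisation against `w • Σ hb Λ|ff + compSumSym` are the road's (E4b) with PART 11's
`perF_dper_LN_eq_sum`); not (K1) for the nested column; not (J-W); no row of the END wrapper discharged; 0 estimates; nothing of Bałaban's asserted, valued or discharged;
0∕4 row-D1 binders (hW, hR, D1Tel, D1Rep); ROOT M‴ p325680 ∕ P5c ∕ D6 untouched; NOT (C1), NOT (L2′), NOT D1, NEVER «G-an2-4 closed», NOT BetaPertH, NOT continuum, NOT Clay.

HONEST DEPENDENCY (page 1, mandatory): continuum YM on T⁴ ⇐ BetaPertH ∧ nine spine estimates (0/9 proved); BetaPertH ⇐ (D1) ∧ (D4) ∧ CAP+tail;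
G-an2-4 gates asym, D1 and NE2/3/4.  HONEST FRAMING (cell contract, verbatim): «discharging `BetaPertH` makes Bałaban's UV stability UNCONDITIONAL —
a real constructive-QFT result; it is NOT the continuum limit and NOT the Clay problem.»  ABSOLUTE RULE (cell charter, verbatim): «No internally-minted
statement may enter as a cited fact. Every hypothesis is either kernel-proved in this package or a verbatim quotation of a PUBLISHED theorem with page
reference. The manuscript(s) under audit are NOT citable for their own disputed steps — they are the thing under adjudication; programme-internal
(2001/route/tribunal) claims are never citable.»  Row D1 ∕ (C1) OWNER an2 (b2b-balaban-beta-an2) gen 61, 2026-08-26.  No existing file touched.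
-/

noncomputable section

open scoped BigOperators

namespace Summit.QuantumFields.BalabanUV.Beta.NVertexLamSectorContracted

open Finset
open Literature.MathematicalPhysics.QuantumFieldTheory
open Literature.MathematicalPhysics.QuantumFieldTheory.Balaban1983to89
open Literature.MathematicalPhysics.QuantumFieldTheory.Balaban1983to89.Beta
open B12Sec2to5 (l1 l1_nonneg)
open B4TorusKernel.MultiPeriod (translate translate_apply)
open ExpKernelCalculus (MKer Decays BiLoc VertexFamily l1_sub_symm)
open AffineAveraging (Site box toSite)
open AveragingHessianKernels (Bond ell)
open OneStepResolventKernel (Fib KInv wsum decays_KInv)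
open OneStepKernelFamily (colH vertexOfK abs_colH_le)
open KernelWard (bdd_of_biLoc)
open InterLevelTransport (SLam)
open StepJetData (wilsonA)
open BalabanStepJets (lamCoeffOf abs_lamCoeffOf_le)
open Summit.QuantumFields.BalabanUV.Beta.AxialDressingRooted (one_le_of_neZero)
open Summit.QuantumFields.BalabanUV.Beta.SymAveragingHessianCounts (symLinKerAt symHessKerAt abs_symLinKerAt_le abs_symHessKerAt_le)
open Summit.QuantumFields.BalabanUV.Beta.CompositeVertexKernelRec (compLinKer compVHKer)
open Summit.QuantumFields.BalabanUV.Beta.CompositeVertexKernelUnroll (liftUp storeyVH compHessFF_unroll_apply)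
open Summit.QuantumFields.BalabanUV.Beta.CompositeVertexKernelLiftContract (tsum_mul_compVHKer_eq)
open Summit.QuantumFields.BalabanUV.Beta.CompositeHessianTable (compHessFF packFF_inl_inl)
open Summit.QuantumFields.BalabanUV.Beta.CompositeOneShotJets (compV compH compH_hH)
open Summit.QuantumFields.BalabanUV.Beta.CompositeOneShotJetData (Roots Pins AN VN)
open Summit.QuantumFields.BalabanUV.Beta.SLamFiniteSourceContraction (SLam_apply_eq)
open Summit.QuantumFields.BalabanUV.Beta.CombHId1Letters (summable_of_translate_bound)
open Summit.QuantumFields.BalabanUV.Beta.NVertexSectors (decays_AN VN_inl_inl)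

variable {d : ℕ}

/-! ## §1 Generic: the column goes onto the coefficients (one Fubini) -/

section Generic

variable {N : ℕ} [NeZero N] {K : MKer (d + 1) (Fib d)} {c : Fin (d + 1) → Site (d + 1) → Fin (d + 1) → Site (d + 1) → ℝ}
  {Q2 : Fin (d + 1) → Site (d + 1) → MKer (d + 1) (Fib d)} {CK δK Cc δc B : ℝ}
  (hK : Decays K CK δK) (hδK : 0 < δK)
  (hc : ∀ (ν : Fin (d + 1)) (w : Site (d + 1)) (κ' : Fin (d + 1)) (u : Site (d + 1)), |c ν w κ' u| ≤ Cc * Real.exp (-δc * l1 ((N : ℤ) • w - u)))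
  (hCc : 0 ≤ Cc) (hδc : 0 < δc) (hQ : ∀ (ν : Fin (d + 1)) (w x z : Site (d + 1)) (a b : Fib d), |Q2 ν w x z a b| ≤ B)
include hK hδK hc hCc hδc hQ

/-- [folklore] **THE 2D SUMMABILITY**: `(u, w) ↦ K u (N•y) (inl κ′) (inr μ) · (c ν w κ′ u · Q2 ν w x z a b)` is absolutely summable on `ℤ^{d+1} × ℤ^{d+1}` (the column decays
from `N•y`, the coefficients decay from the fine bond `u` along the coarse copies `N•w`, the table is bounded — an2 g42's `summable_of_translate_bound` after `w ↦ −w`). -/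
theorem summable_col_coeff_table (κ' μ ν : Fin (d + 1)) (y x z : Site (d + 1)) (a b : Fib d) :
    Summable fun p : Site (d + 1) × Site (d + 1) =>
      K p.1 ((N : ℤ) • y) (Sum.inl κ') (Sum.inr μ) * (c ν p.2 κ' p.1 * Q2 ν p.2 x z a b) := by
  have hCK : 0 ≤ CK := hK.nonneg (Sum.inl 0)
  have hB : 0 ≤ B := (abs_nonneg _).trans (hQ ν 0 0 0 (Sum.inl 0) (Sum.inl 0))
  -- the reflected family `(u, n) ↦ (u, −n)` has the tool's shape with `M := N`, `p := 0`, `q := N•y`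
  have hf : Summable fun p : Site (d + 1) × Site (d + 1) =>
      K p.1 ((N : ℤ) • y) (Sum.inl κ') (Sum.inr μ) * (c ν (-p.2) κ' p.1 * Q2 ν (-p.2) x z a b) := by
    refine summable_of_translate_bound (fun _ : Fin (d + 1) => N) (C := CK * (Cc * B)) (mul_nonneg hCK (mul_nonneg hCc hB)) hδc hδK 0
      ((N : ℤ) • y) (f := fun p : Site (d + 1) × Site (d + 1) =>
        K p.1 ((N : ℤ) • y) (Sum.inl κ') (Sum.inr μ) * (c ν (-p.2) κ' p.1 * Q2 ν (-p.2) x z a b)) fun u n => ?_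
    have h1 : |K u ((N : ℤ) • y) (Sum.inl κ') (Sum.inr μ)| ≤ CK * Real.exp (-δK * l1 ((N : ℤ) • y - u)) := by
      have h := abs_colH_le (N := N) hK μ y κ' u
      rw [l1_sub_symm] at h
      exact h
    have h2 : |c ν (-n) κ' u| ≤ Cc * Real.exp (-δc * l1 (translate (fun _ : Fin (d + 1) => N) u n - 0)) := by
      have h := hc ν (-n) κ' u
      have e : l1 ((N : ℤ) • (-n) - u) = l1 (translate (fun _ : Fin (d + 1) => N) u n - 0) := by
        rw [sub_zero, l1_sub_symm, show u - (N : ℤ) • (-n) = translate (fun _ : Fin (d + 1) => N) u n from ?_]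
        funext i
        simp only [Pi.sub_apply, Pi.smul_apply, Pi.neg_apply, smul_eq_mul, translate_apply]
        ring
      rw [e] at h
      exact h
    have h3 := hQ ν (-n) x z a b
    rw [abs_mul, abs_mul]
    calc |K u ((N : ℤ) • y) (Sum.inl κ') (Sum.inr μ)| * (|c ν (-n) κ' u| * |Q2 ν (-n) x z a b|)
        ≤ (CK * Real.exp (-δK * l1 ((N : ℤ) • y - u))) * ((Cc * Real.exp (-δc * l1 (translate (fun _ : Fin (d + 1) => N) u n - 0))) * B) :=
          mul_le_mul h1 (mul_le_mul h2 h3 (abs_nonneg _) (mul_nonneg hCc (Real.exp_pos _).le)) (mul_nonneg (abs_nonneg _) (abs_nonneg _))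
            (mul_nonneg hCK (Real.exp_pos _).le)
      _ = CK * (Cc * B) * Real.exp (-δc * l1 (translate (fun _ : Fin (d + 1) => N) u n - 0)) * Real.exp (-δK * l1 ((N : ℤ) • y - u)) := by ring
  -- undo the reflection `w ↦ −w`
  refine (hf.comp_injective (Equiv.prodCongr (Equiv.refl (Site (d + 1))) (Equiv.neg (Site (d + 1)))).injective).congr ?_
  rintro ⟨u, w⟩
  show K u ((N : ℤ) • y) (Sum.inl κ') (Sum.inr μ) * (c ν (-(-w)) κ' u * Q2 ν (-(-w)) x z a b) = _
  rw [neg_neg]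

/-- [folklore] one column term against the Λ-stencil, contracted: `Σ'_u K u (N•y) (inl κ′) (inr μ) · SLam N c Q2 κ′ u x z a b = −Σ_ν Σ'_w (Σ'_u K u … · c ν w κ′ u) · Q2 ν w x z a b`. -/
theorem tsum_col_mul_SLam_apply (κ' μ : Fin (d + 1)) (y x z : Site (d + 1)) (a b : Fib d) :
    ∑' u : Site (d + 1), K u ((N : ℤ) • y) (Sum.inl κ') (Sum.inr μ) * SLam N c Q2 κ' u x z a b
      = -∑ ν : Fin (d + 1), ∑' w : Site (d + 1),
          (∑' u : Site (d + 1), K u ((N : ℤ) • y) (Sum.inl κ') (Sum.inr μ) * c ν w κ' u) * Q2 ν w x z a b := by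
  have hsw : ∀ ν : Fin (d + 1), Summable fun p : Site (d + 1) × Site (d + 1) =>
      K p.1 ((N : ℤ) • y) (Sum.inl κ') (Sum.inr μ) * (c ν p.2 κ' p.1 * Q2 ν p.2 x z a b) :=
    fun ν => summable_col_coeff_table hK hδK hc hCc hδc hQ κ' μ ν y x z a b
  -- the swapped uncurried family (for the exchange) and the row sums (for the finite `ν`-sum)
  have hsw' : ∀ ν : Fin (d + 1), Summable (Function.uncurry fun (w u : Site (d + 1)) =>
      K u ((N : ℤ) • y) (Sum.inl κ') (Sum.inr μ) * (c ν w κ' u * Q2 ν w x z a b)) := fun ν => (hsw ν).prod_symm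
  have hrow : ∀ ν ∈ (Finset.univ : Finset (Fin (d + 1))), Summable fun u : Site (d + 1) =>
      ∑' w : Site (d + 1), K u ((N : ℤ) • y) (Sum.inl κ') (Sum.inr μ) * (c ν w κ' u * Q2 ν w x z a b) := fun ν _ => (hsw ν).prod
  have h1 : ∀ u : Site (d + 1), K u ((N : ℤ) • y) (Sum.inl κ') (Sum.inr μ) * SLam N c Q2 κ' u x z a b
      = -∑ ν : Fin (d + 1), ∑' w : Site (d + 1), K u ((N : ℤ) • y) (Sum.inl κ') (Sum.inr μ) * (c ν w κ' u * Q2 ν w x z a b) := fun u => by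
    rw [SLam_apply_eq, mul_neg, Finset.mul_sum]
    congr 1
    refine Finset.sum_congr rfl fun ν _ => ?_
    rw [tsum_mul_left]
  rw [tsum_congr h1, tsum_neg, Summable.tsum_finsetSum hrow]
  congr 1
  refine Finset.sum_congr rfl fun ν _ => ?_
  rw [(hsw' ν).tsum_comm]
  refine tsum_congr fun w => ?_
  rw [← tsum_mul_right]
  exact tsum_congr fun u => by ring

/-- [folklore] **`vertexOfK_SLam_apply_contracted` — THE CHAIN-RULE VERTEX OF A Λ-STENCIL, CONTRACTED ONTO THE COEFFICIENTS**: for a decaying column kernel `K`, coefficients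
decaying from the fine bond and a bounded table,
`vertexOfK K N (SLam N c Q2) μ y x z a b = −Σ_ν Σ'_w (Σ_{κ′} Σ'_u K u (N•y) (inl κ′) (inr μ) · c ν w κ′ u) · Q2 ν w x z a b`. -/
theorem vertexOfK_SLam_apply_contracted (μ : Fin (d + 1)) (y x z : Site (d + 1)) (a b : Fib d) :
    vertexOfK K N (SLam N c Q2) μ y x z a b
      = -∑ ν : Fin (d + 1), ∑' w : Site (d + 1),
          (∑ κ' : Fin (d + 1), ∑' u : Site (d + 1), K u ((N : ℤ) • y) (Sum.inl κ') (Sum.inr μ) * c ν w κ' u) * Q2 ν w x z a b := by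
  have hsw : ∀ κ' ν : Fin (d + 1), Summable fun p : Site (d + 1) × Site (d + 1) =>
      K p.1 ((N : ℤ) • y) (Sum.inl κ') (Sum.inr μ) * (c ν p.2 κ' p.1 * Q2 ν p.2 x z a b) :=
    fun κ' ν => summable_col_coeff_table hK hδK hc hCc hδc hQ κ' μ ν y x z a b
  -- per `w`, the `u`-sum of each `κ′`-slice times the table is summable in `w`
  have hws : ∀ κ' ν : Fin (d + 1), Summable fun w : Site (d + 1) =>
      (∑' u : Site (d + 1), K u ((N : ℤ) • y) (Sum.inl κ') (Sum.inr μ) * c ν w κ' u) * Q2 ν w x z a b := fun κ' ν => by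
    have h := (hsw κ' ν).prod_symm.prod
    refine h.congr fun w => ?_
    show ∑' u : Site (d + 1), K u ((N : ℤ) • y) (Sum.inl κ') (Sum.inr μ) * (c ν w κ' u * Q2 ν w x z a b) = _
    rw [← tsum_mul_right]
    exact tsum_congr fun u => by ring
  show ∑ κ' : Fin (d + 1), ∑' u : Site (d + 1), K u ((N : ℤ) • y) (Sum.inl κ') (Sum.inr μ) * SLam N c Q2 κ' u x z a b = _
  simp only [tsum_col_mul_SLam_apply hK hδK hc hCc hδc hQ]
  rw [Finset.sum_neg_distrib, Finset.sum_comm]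
  congr 1
  refine Finset.sum_congr rfl fun ν _ => ?_
  rw [← Summable.tsum_finsetSum (fun κ' _ => hws κ' ν)]
  refine tsum_congr fun w => ?_
  rw [Finset.sum_mul]

omit hQ in
/-- [folklore] **the CONTRACTED COEFFICIENTS are summable in the multiplier slot** `w` (the letter F6a‴'s `tsum_mul_liftUp_eq` ∕ `tsum_mul_compVHKer_eq` ask of a top
covector): `w ↦ Σ_{κ′} Σ'_u K u (N•y) (inl κ′) (inr μ) · c ν w κ′ u` (the 2D summability at the constant table `1`). -/
theorem summable_contracted_coeff (μ ν : Fin (d + 1)) (y : Site (d + 1)) :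
    Summable fun w : Site (d + 1) => ∑ κ' : Fin (d + 1), ∑' u : Site (d + 1), K u ((N : ℤ) • y) (Sum.inl κ') (Sum.inr μ) * c ν w κ' u := by
  refine summable_sum fun κ' _ => ?_
  have h := (summable_col_coeff_table (Q2 := fun _ _ => fun _ _ _ _ => (1 : ℝ)) (B := 1) hK hδK hc hCc hδc
    (fun _ _ _ _ _ _ => by rw [abs_one]) κ' μ ν y 0 0 (Sum.inl 0) (Sum.inl 0)).prod_symm.prod
  refine h.congr fun w => ?_
  exact tsum_congr fun u => by dsimp only [Prod.swap]; rw [mul_one]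

end Generic

/-! ## §2 At the record: the Λ sector of `VN|ff`, contracted -/

section Record

variable {Lc : ℕ} [NeZero Lc] (R : Roots Lc) (P : Pins) (j : ℕ)

/-- [folklore] the composite constraint-Hessian table is uniformly bounded ((LH) at rate `1`, lit `bdd_of_biLoc`). -/
theorem bdd_compH : ∃ B : ℝ, ∀ (ν : Fin (3 + 1)) (w x z : Site (3 + 1)) (a b : Fib 3), |compH R.r Lc (j + 1) ν w x z a b| ≤ B := by
  obtain ⟨C, hC⟩ := compH_hH (j + 1) (one_le_of_neZero Lc) R.hr 1 zero_le_one
  exact ⟨C, fun ν w x z a b => bdd_of_biLoc (hC ν w) zero_le_one x z a b⟩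

/-- [folklore] **`LN_inl_inl_contracted` — THE Λ SECTOR OF THE N-VERTEX, CONTRACTED ONTO THE MULTIPLIER COEFFICIENTS** (every block; in particular the field block):
`ℒN μ y x z a b = −Σ_ν Σ'_w Λ′_N μ y ν w · compH R.r Lc (j+1) ν w x z a b`, `Λ′_N μ y ν w = Σ_{κ′} Σ'_u (AN R j) u (L•y) (inl κ′) (inr μ) · lamCoeffOf (KInv L) L ν w κ′ u`, `L = Lc^(j+1)`. -/
theorem LN_inl_inl_contracted (μ : Fin (3 + 1)) (y x z : Site (3 + 1)) (a b : Fib 3) :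
    vertexOfK (AN R j) (Lc ^ (j + 1))
        (SLam (Lc ^ (j + 1)) (lamCoeffOf (KInv (N := Lc ^ (j + 1)) (d := 3)) (Lc ^ (j + 1))) (compH R.r Lc (j + 1))) μ y x z a b
      = -∑ ν : Fin (3 + 1), ∑' w : Site (3 + 1),
          (∑ κ' : Fin (3 + 1), ∑' u : Site (3 + 1),
              AN R j u (((Lc ^ (j + 1) : ℕ) : ℤ) • y) (Sum.inl κ') (Sum.inr μ) * lamCoeffOf (KInv (N := Lc ^ (j + 1)) (d := 3)) (Lc ^ (j + 1)) ν w κ' u)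
            * compH R.r Lc (j + 1) ν w x z a b := by
  obtain ⟨δK, CK, hδK, -, hK⟩ := decays_AN R j
  obtain ⟨δ₀, C, hδ₀, hC, hdec⟩ := decays_KInv (N := Lc ^ (j + 1)) (d := 3)
  have hc := abs_lamCoeffOf_le (N := Lc ^ (j + 1)) hdec hC hδ₀.le
  obtain ⟨B, hB⟩ := bdd_compH R j
  exact vertexOfK_SLam_apply_contracted (N := Lc ^ (j + 1)) hK hδK (fun ν w κ' u => hc ν w κ' u)
    (mul_nonneg (mul_nonneg (by positivity) hC) (Real.exp_pos _).le) hδ₀ hB μ y x z a b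

/-- [folklore] **the contracted multiplier response `Λ′_N μ y ν ·` is summable** (letter for the storey currency, F6a‴). -/
theorem summable_LamN (μ ν : Fin (3 + 1)) (y : Site (3 + 1)) :
    Summable fun w : Site (3 + 1) => ∑ κ' : Fin (3 + 1), ∑' u : Site (3 + 1),
      AN R j u (((Lc ^ (j + 1) : ℕ) : ℤ) • y) (Sum.inl κ') (Sum.inr μ) * lamCoeffOf (KInv (N := Lc ^ (j + 1)) (d := 3)) (Lc ^ (j + 1)) ν w κ' u := by
  obtain ⟨δK, CK, hδK, -, hK⟩ := decays_AN R j
  obtain ⟨δ₀, C, hδ₀, hC, hdec⟩ := decays_KInv (N := Lc ^ (j + 1)) (d := 3)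
  have hc := abs_lamCoeffOf_le (N := Lc ^ (j + 1)) hdec hC hδ₀.le
  exact summable_contracted_coeff (N := Lc ^ (j + 1)) hK hδK (fun ν w κ' u => hc ν w κ' u)
    (mul_nonneg (mul_nonneg (by positivity) hC) (Real.exp_pos _).le) hδ₀ μ ν y

/-- [folklore] **`VN_inl_inl_contracted` — THE FIELD BLOCK OF THE N-VERTEX: WILSON SECTOR + CONTRACTED Λ SECTOR**:
`VN R P j μ y x z (inl α) (inl β) = cE (j+1)·𝒲N μ y x z (inl α) (inl β) − cΛ (j+1)·Σ_ν Σ'_w Λ′_N μ y ν w · compH R.r Lc (j+1) ν w x z (inl α) (inl β)`. -/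
theorem VN_inl_inl_contracted (μ : Fin (3 + 1)) (y x z : Site (3 + 1)) (α β : Fin (3 + 1)) :
    VN R P j μ y x z (Sum.inl α) (Sum.inl β)
      = P.cE (j + 1) * vertexOfK (AN R j) (Lc ^ (j + 1)) (wilsonA 3) μ y x z (Sum.inl α) (Sum.inl β)
        - P.cΛ (j + 1) * ∑ ν : Fin (3 + 1), ∑' w : Site (3 + 1),
            (∑ κ' : Fin (3 + 1), ∑' u : Site (3 + 1),
                AN R j u (((Lc ^ (j + 1) : ℕ) : ℤ) • y) (Sum.inl κ') (Sum.inr μ) * lamCoeffOf (KInv (N := Lc ^ (j + 1)) (d := 3)) (Lc ^ (j + 1)) ν w κ' u)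
              * compH R.r Lc (j + 1) ν w x z (Sum.inl α) (Sum.inl β) := by
  rw [VN_inl_inl, LN_inl_inl_contracted, mul_neg, sub_eq_add_neg]

end Record

/-! ## §3 The composite constraint-Hessian table's field block by storeys -/

section Storeys

/-- [folklore] **the field block of the composite constraint-Hessian table, unrolled by storeys** (F6a′ `compHessFF_unroll_apply`, `packFF_inl_inl`), at the (0.4)-symmetrised bricks:
`compH r L m ν w x z (inl α) (inl β) = Σ_{k<m} liftUp ℓ L k (storeyVH ℓ 𝒽 L k · · (α,x) (β,z)) (m−1−k) ν w`, `ℓ _ := symLinKerAt (toSite r) L`, `𝒽 _ := symHessKerAt (toSite r) L`. -/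
theorem compH_inl_inl_unroll (r : Fin (d + 1) → ℕ) (L m : ℕ) (ν : Fin (d + 1)) (w x z : Site (d + 1)) (α β : Fin (d + 1)) :
    compH r L m ν w x z (Sum.inl α) (Sum.inl β)
      = ∑ k ∈ range m, liftUp (fun _ => symLinKerAt (toSite r) L) L k
          (fun μ' y' => storeyVH (fun _ => symLinKerAt (toSite r) L) (fun _ => symHessKerAt (toSite r) L) L k μ' y' (α, x) (β, z)) (m - 1 - k) ν w := by
  rw [compH, compHessFF_unroll_apply, packFF_inl_inl]

/-- [folklore] the field block of the composite constraint-Hessian table IS F3's composite vertex kernel at the symmetrised bricks (F6a `compHessFF = packFF …`). -/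
theorem compH_inl_inl_eq_compVHKer (r : Fin (d + 1) → ℕ) (L m : ℕ) (ν : Fin (d + 1)) (w x z : Site (d + 1)) (α β : Fin (d + 1)) :
    compH r L m ν w x z (Sum.inl α) (Sum.inl β)
      = compVHKer (fun _ => symLinKerAt (toSite r) L) (fun _ => symHessKerAt (toSite r) L) L m ν w (α, x) (β, z) := by
  simp only [compH, compHessFF, packFF_inl_inl]

variable {Lc : ℕ} [NeZero Lc] (R : Roots Lc) (j : ℕ)

/-- [folklore] **`tsum_LamN_mul_compH_inl_inl_storeys` — THE CONTRACTED Λ SECTOR IN STOREY CURRENCY** (F6a‴ `tsum_mul_compVHKer_eq` at the contracted multiplier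
response, summable by `summable_LamN`, with the symmetrised bricks' bounds `abs_symLinKerAt_le` ∕ `abs_symHessKerAt_le`): one constraint-Hessian brick per storey `k ≤ j`
along transported legs, weighted by the multiplier response pulled back through the `j − k` steps above it —
`Σ'_w Λ′_N μ y ν w · compH R.r Lc (j+1) ν w x z (inl α) (inl β) = Σ_{k ≤ j} Σ_κ Σ'_s (Σ'_w Λ′_N μ y ν w · compLinKer ℓ Lc (j−k) (κ,s) (ν,w)) · storeyVH ℓ 𝒽 Lc k κ s (α,x) (β,z)`. -/
theorem tsum_LamN_mul_compH_inl_inl_storeys (μ ν : Fin (3 + 1)) (y x z : Site (3 + 1)) (α β : Fin (3 + 1)) :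
    ∑' w : Site (3 + 1),
        (∑ κ' : Fin (3 + 1), ∑' u : Site (3 + 1),
            AN R j u (((Lc ^ (j + 1) : ℕ) : ℤ) • y) (Sum.inl κ') (Sum.inr μ) * lamCoeffOf (KInv (N := Lc ^ (j + 1)) (d := 3)) (Lc ^ (j + 1)) ν w κ' u)
          * compH R.r Lc (j + 1) ν w x z (Sum.inl α) (Sum.inl β)
      = ∑ k ∈ range (j + 1), ∑ κ : Fin (3 + 1), ∑' s : Site (3 + 1),
          (∑' w : Site (3 + 1),
              (∑ κ' : Fin (3 + 1), ∑' u : Site (3 + 1),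
                  AN R j u (((Lc ^ (j + 1) : ℕ) : ℤ) • y) (Sum.inl κ') (Sum.inr μ) * lamCoeffOf (KInv (N := Lc ^ (j + 1)) (d := 3)) (Lc ^ (j + 1)) ν w κ' u)
                * compLinKer (fun _ => symLinKerAt (toSite R.r) Lc) Lc (j - k) (κ, s) (ν, w))
            * storeyVH (fun _ => symLinKerAt (toSite R.r) Lc) (fun _ => symHessKerAt (toSite R.r) Lc) Lc k κ s (α, x) (β, z) := by
  have hL : 0 < Lc := Nat.pos_of_ne_zero (NeZero.ne Lc)
  have hL1 : 1 ≤ Lc := one_le_of_neZero Lc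
  have h := tsum_mul_compVHKer_eq (ℓ := fun _ => symLinKerAt (toSite R.r) Lc) (𝓋 := fun _ => symHessKerAt (toSite R.r) Lc) (L := Lc)
    hL (by positivity : (0 : ℝ) ≤ (ell (3 + 1) Lc : ℝ)) (fun _ μ' y' f => abs_symLinKerAt_le hL1 μ' y' R.hr f)
    (by positivity : (0 : ℝ) ≤ 2 * (ell (3 + 1) Lc : ℝ) ^ 2) (fun _ μ' y' f f' => abs_symHessKerAt_le hL1 μ' y' R.hr f f') (j + 1)
    (summable_LamN R j μ ν y) ν (α, x) (β, z)
  simp only [compH_inl_inl_eq_compVHKer]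
  rw [h]
  refine Finset.sum_congr rfl fun k _ => ?_
  rw [show j + 1 - 1 - k = j - k by omega]

end Storeys

end Summit.QuantumFields.BalabanUV.Beta.NVertexLamSectorContracted

end
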